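import Summits.CriticalPhenomena.PercolationContinuityZ3.Theorems.PercNearOneGluingNoHeavyLowerTailCovTauMetaA2Defs
import HarnessLib

/-!
# Mixed conditioned slack hierarchy — the HUB observer functional in the finite-sum world framework, with its star decomposition

Definitions file (`--supports stmt-CriticalPhenomena-4575`), prover `prim-ineq-gen-7` (gen 8).  No sorries, no named facts.
Memo `prim-ineq-gen-7/Q9-WRITEUP.md` Lemma 5.2 / blueprint `PROOF-Q9-MIXED-CSH.md` §10 brick B4 (first part).

In the `BHK2006` finite-sum framework of `CovTau` (worlds `G[U]`, clusters `rC U s ω`, avoidance events `rD U s X`, neighbour sets `rS U Z ω`) we add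
the objects needed to run `CovTau.metaA2_abstract` (p212087) with the HUB functional of the mixed hierarchy (the observer `o` glued to a vertex set `Σ`):

* `CovTau.avoidAll U Σ X` — the event "every `σ ∈ Σ` lies in `U` and avoids `X` in `G[U]`" (`Σ ⊆ U` and `Σ ↮ X`);
* `CovTau.hubInd Σ v` — `1{Σ ∩ C_v ≠ ∅}` as a monotone function of the open EDGE cluster of `v` (like `CovTau.oInd`);
* `CovTau.EavMix w U A Σ v N = μ_{G[U]}(Σ ∩ C_v ≠ ∅, v ↮ A ∪ N, Σ ⊆ U, Σ ↮ A ∪ N)` — the hub analogue `⟨e⟩_N` of `CovTau.Eav` (memo Lemma 5.2);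
* the MULTI-CLUSTER STAR DECOMPOSITION `CovTau.multiStep_sum` — BHK's identity (6) for integrands `H(C_s)·1{s ↮ W}·1{avoidAll U Σ W'}` (several clusters
  avoiding a set containing `Z` live in `G[U ∖ Z]` and avoid the neighbour set of `Z`), generalising `BHK2006.step_sum`; and its corollary `CovTau.EavMix_step`;
* elementary API: `EavMix` is nonnegative, antitone in `N`, `≤ Mav`, vanishes when `v ∈ A ∪ N`, and only sees `(A ∪ N) ∩ U`.
[cite: VandenbergHaggstromKahn2005, §1 p. 4, identity (6)] [cite: KozmaNitzan2024, Question 9 (§5.5 p. 36)]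
-/

noncomputable section

namespace Summit.CriticalPhenomena.PercolationContinuityZ3.Theorems.CovTau

open Literature.Probability.Percolation
open Literature.Probability.Percolation.BHK2006
open Literature.Probability.Percolation.DecisionTree (ind ind_of_mem ind_of_not_mem ind_nonneg)
open scoped Classical

variable {V : Type*}

/-! ### The hub objects -/

/-- The event "every `σ ∈ Σ` is a vertex of `U` and is joined to no vertex of `X` inside `G[U]`" (`Σ ⊆ U ∧ Σ ↮ X`).
[cite: VandenbergHaggstromKahn2005, §1 p. 3 (the events `R_X`)] -/
def avoidAll (U Sig : Finset V) (X : Set V) : Set (Set (Sym2 V)) :=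
  {ω | ∀ σ ∈ Sig, σ ∈ U ∧ ω ∈ rD U σ X}

/-- `1{Σ ∩ C_v ≠ ∅}` as a (monotone) function of the open EDGE cluster `C` of `v`: some `σ ∈ Σ` equals `v` or lies on an edge of `C`.
[cite: KozmaNitzan2024, §5.5 p. 36 (the observer `o` joined to the cluster)] -/
def hubInd (Sig : Finset V) (v : V) (C : Set (Sym2 V)) : ℝ :=
  ind {C : Set (Sym2 V) | ∃ σ ∈ Sig, σ = v ∨ ∃ e ∈ C, σ ∈ e} C

/-- Unfolding of `avoidAll`. [folklore] -/
theorem mem_avoidAll {U Sig : Finset V} {X : Set V} {ω : Set (Sym2 V)} :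
    ω ∈ avoidAll U Sig X ↔ ∀ σ ∈ Sig, σ ∈ U ∧ ω ∈ rD U σ X := Iff.rfl

/-- `avoidAll` is antitone in the avoided set. [folklore] -/
theorem avoidAll_antitone (U Sig : Finset V) {X X' : Set V} (h : X ⊆ X') : avoidAll U Sig X' ⊆ avoidAll U Sig X :=
  fun _ hω σ hσ => ⟨(hω σ hσ).1, rD_antitone h (hω σ hσ).2⟩

/-- `avoidAll` only depends on the avoided set through its trace on `U`. [folklore] -/
theorem avoidAll_eq_of_agree (U Sig : Finset V) {X Y : Set V} (h : ∀ a ∈ U, a ∈ X ↔ a ∈ Y) :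
    avoidAll U Sig X = avoidAll U Sig Y := by
  ext ω
  simp only [mem_avoidAll]
  exact forall₂_congr fun σ _ => and_congr_right fun hσU => by rw [rD_eq_of_agree U hσU h]

/-- `hubInd ≥ 0`. [folklore] -/
theorem hubInd_nonneg (Sig : Finset V) (v : V) (C : Set (Sym2 V)) : 0 ≤ hubInd Sig v C := ind_nonneg _ _

/-- `hubInd ≤ 1`. [folklore] -/
theorem hubInd_le_one (Sig : Finset V) (v : V) (C : Set (Sym2 V)) : hubInd Sig v C ≤ 1 := ind_le_one _ _

/-- `hubInd Σ v` is monotone in the edge set. [folklore] -/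
theorem hubInd_mono (Sig : Finset V) (v : V) : Monotone (hubInd Sig v) := by
  intro C C' h
  by_cases hC : C ∈ {C : Set (Sym2 V) | ∃ σ ∈ Sig, σ = v ∨ ∃ e ∈ C, σ ∈ e}
  · have hC' : C' ∈ {C : Set (Sym2 V) | ∃ σ ∈ Sig, σ = v ∨ ∃ e ∈ C, σ ∈ e} := by
      obtain ⟨σ, hσ, h1 | ⟨e, he, hσe⟩⟩ := hC
      · exact ⟨σ, hσ, Or.inl h1⟩
      · exact ⟨σ, hσ, Or.inr ⟨e, h he, hσe⟩⟩
    unfold hubInd; rw [ind_of_mem hC, ind_of_mem hC']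
  · unfold hubInd; rw [ind_of_not_mem hC]; exact ind_nonneg _ _

/-! ### The multi-cluster star decomposition -/

/-- Restriction of `avoidAll` to `G[U ∖ Z]` for `Z ⊆ X` (each `σ ∉ Z` by `BHK2006.mem_rD_iff_restrict`; a `σ ∈ Z` violates both sides).
[cite: VandenbergHaggstromKahn2005, §1 p. 4, identity (6)] -/
theorem mem_avoidAll_iff_restrict {U Z : Finset V} (hZU : Z ⊆ U) (Sig : Finset V) {X : Set V}
    (hZX : (↑Z : Set V) ⊆ X) (ω : Set (Sym2 V)) :
    ω ∈ avoidAll U Sig X ↔ ω ∈ avoidAll (U \ Z) Sig ((X \ ↑Z) ∪ rS U Z ω) := by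
  simp only [mem_avoidAll]
  refine forall₂_congr fun σ _ => ?_
  by_cases hσZ : σ ∈ Z
  · have h1 : ω ∉ rD U σ X := fun h => h σ (hZX hσZ) (SimpleGraph.Reachable.refl σ)
    have h2 : σ ∉ U \ Z := fun h => (Finset.mem_sdiff.1 h).2 hσZ
    exact ⟨fun h => absurd h.2 h1, fun h => absurd h.1 h2⟩
  · rw [mem_rD_iff_restrict hZU hσZ hZX ω, Finset.mem_sdiff]
    exact ⟨fun h => ⟨⟨h.1, hσZ⟩, h.2⟩, fun h => ⟨h.1.1, h.2⟩⟩

/-- The events `avoidAll (U ∖ Z) Σ T` do not depend on the edges meeting `Z`. [folklore] -/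
theorem mem_avoidAll_diff_meeting (U Z Sig : Finset V) (T : Set V) (ω : Set (Sym2 V)) :
    ω \ meeting Z ∈ avoidAll (U \ Z) Sig T ↔ ω ∈ avoidAll (U \ Z) Sig T := by
  simp only [mem_avoidAll, mem_rD_diff_meeting]

variable [Fintype V]

/-- **Multi-cluster star decomposition (BHK's (6))**: for `Z ⊆ U`, `s ∉ Z`, `Z ⊆ W`, `Z ⊆ W'`,
`E_U[H(C_s)·1{s ↮ W}·1{Σ ⊆ U, Σ ↮ W'}] = Σ_ω weight(ω) · E_{U∖Z}[H(C_s)·1{s ↮ (W∖Z) ∪ S(ω)}·1{Σ ⊆ U∖Z, Σ ↮ (W'∖Z) ∪ S(ω)}]`,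
conditioning on the set `S(ω)` of vertices joined to `Z` by an open edge (all the clusters involved avoid `Z`, hence live in `G[U ∖ Z]` and avoid `S`).
[cite: VandenbergHaggstromKahn2005, §1 p. 4, identity (6)] -/
theorem multiStep_sum {U Z : Finset V} (hZU : Z ⊆ U) {s : V} (hs : s ∉ Z) {W : Set V}
    (hZW : (↑Z : Set V) ⊆ W) (Sig : Finset V) {W' : Set V} (hZW' : (↑Z : Set V) ⊆ W')
    (w : Sym2 V → ℝ) (hm : ∑ ω, weight w ω = 1) (H : Set (Sym2 V) → ℝ) :
    ∑ ω, weight w ω * (H (rC U s ω) * ind (rD U s W) ω * ind (avoidAll U Sig W') ω) =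
      ∑ ω, weight w ω * ∑ ω', weight w ω' *
        (H (rC (U \ Z) s ω') * ind (rD (U \ Z) s ((W \ ↑Z) ∪ rS U Z ω)) ω' *
          ind (avoidAll (U \ Z) Sig ((W' \ ↑Z) ∪ rS U Z ω)) ω') := by
  set A := meeting Z with hA
  set Φ : Set (Sym2 V) → Set (Sym2 V) → ℝ := fun ζ η =>
    H (rC (U \ Z) s η) * ind (rD (U \ Z) s ((W \ ↑Z) ∪ rS U Z ζ)) η *
      ind (avoidAll (U \ Z) Sig ((W' \ ↑Z) ∪ rS U Z ζ)) η with hΦ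
  have h1 : ∀ ω, H (rC U s ω) * ind (rD U s W) ω * ind (avoidAll U Sig W') ω = Φ (ω ∩ A) (ω \ A) := by
    intro ω
    simp only [hΦ, hA, rS_inter_meeting, rC_diff_meeting]
    have hav : ind (avoidAll U Sig W') ω =
        ind (avoidAll (U \ Z) Sig ((W' \ ↑Z) ∪ rS U Z ω)) (ω \ meeting Z) := by
      by_cases hω : ω ∈ avoidAll U Sig W'
      · rw [ind_of_mem hω, ind_of_mem ((mem_avoidAll_diff_meeting U Z Sig _ ω).2
          ((mem_avoidAll_iff_restrict hZU Sig hZW' ω).1 hω))]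
      · rw [ind_of_not_mem hω, ind_of_not_mem fun h =>
          hω ((mem_avoidAll_iff_restrict hZU Sig hZW' ω).2 ((mem_avoidAll_diff_meeting U Z Sig _ ω).1 h))]
    by_cases hω : ω ∈ rD U s W
    · have hω' := (mem_rD_iff_restrict hZU hs hZW ω).1 hω
      rw [ind_of_mem hω, ind_of_mem ((mem_rD_diff_meeting U Z s _ ω).2 hω'),
        rC_restrict hs fun n hn => hω' n (Or.inr hn), hav]
    · have hω' : ω \ meeting Z ∉ rD (U \ Z) s ((W \ ↑Z) ∪ rS U Z ω) := fun h =>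
        hω ((mem_rD_iff_restrict hZU hs hZW ω).2 ((mem_rD_diff_meeting U Z s _ ω).1 h))
      rw [ind_of_not_mem hω, ind_of_not_mem hω']
      simp only [mul_zero, zero_mul]
  have h2 : ∀ ω ω', Φ (ω ∩ A) (ω' \ A) =
      H (rC (U \ Z) s ω') * ind (rD (U \ Z) s ((W \ ↑Z) ∪ rS U Z ω)) ω' *
        ind (avoidAll (U \ Z) Sig ((W' \ ↑Z) ∪ rS U Z ω)) ω' := by
    intro ω ω'
    simp only [hΦ, hA, rS_inter_meeting, rC_diff_meeting]
    have hav : ind (avoidAll (U \ Z) Sig ((W' \ ↑Z) ∪ rS U Z ω)) (ω' \ meeting Z) =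
        ind (avoidAll (U \ Z) Sig ((W' \ ↑Z) ∪ rS U Z ω)) ω' := by
      by_cases hω' : ω' ∈ avoidAll (U \ Z) Sig ((W' \ ↑Z) ∪ rS U Z ω)
      · rw [ind_of_mem hω', ind_of_mem ((mem_avoidAll_diff_meeting U Z Sig _ ω').2 hω')]
      · rw [ind_of_not_mem hω', ind_of_not_mem fun h => hω' ((mem_avoidAll_diff_meeting U Z Sig _ ω').1 h)]
    by_cases hω' : ω' ∈ rD (U \ Z) s ((W \ ↑Z) ∪ rS U Z ω)
    · rw [ind_of_mem hω', ind_of_mem ((mem_rD_diff_meeting U Z s _ ω').2 hω'), hav]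
    · rw [ind_of_not_mem hω', ind_of_not_mem (fun h => hω' ((mem_rD_diff_meeting U Z s _ ω').1 h))]
      simp only [mul_zero, zero_mul]
  calc ∑ ω, weight w ω * (H (rC U s ω) * ind (rD U s W) ω * ind (avoidAll U Sig W') ω)
      = (∑ ω, weight w ω) * ∑ ω, weight w ω * Φ (ω ∩ A) (ω \ A) := by
        rw [hm, one_mul]; simp_rw [h1]
    _ = ∑ ω, weight w ω * ∑ ω', weight w ω' * Φ (ω ∩ A) (ω' \ A) := blockFubini w A Φ
    _ = _ := by simp_rw [h2]

/-! ### The hub observer functional `⟨e⟩_N` -/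

/-- `E^mix_A(N) = μ_{G[U]}(Σ ∩ C_v ≠ ∅, v ↮ A ∪ N, Σ ⊆ U, Σ ↮ A ∪ N)` — the hub analogue of `CovTau.Eav` (memo Lemma 5.2: `⟨e⟩_N`).
[cite: KozmaNitzan2024, Question 9 (§5.5 p. 36)] [cite: VandenbergHaggstromKahn2005, §1 p. 3] -/
def EavMix (w : Sym2 V → ℝ) (U : Finset V) (A : Set V) (Sig : Finset V) (v : V) (N : Set V) : ℝ :=
  ∑ ω, weight w ω * (hubInd Sig v (rC U v ω) * ind (rD U v (A ∪ N)) ω * ind (avoidAll U Sig (A ∪ N)) ω)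

/-- Star decomposition of `E^mix_A`: `E^mix_U(N) = Σ_ω weight(ω) · E^mix_{U∖Z}((N ∖ Z) ∪ S(ω))` for `Z ⊆ N`, `v ∉ Z`, `v ∈ U`
(`multiStep_sum`; the members of `A ∩ Z` are invisible in `G[U ∖ Z]`). [cite: VandenbergHaggstromKahn2005, §1 p. 4, identity (6)] -/
theorem EavMix_step {U Z : Finset V} (hZU : Z ⊆ U) {v : V} (hvU : v ∈ U) (hv : v ∉ Z) {A N : Set V}
    (hZN : (↑Z : Set V) ⊆ N) (w : Sym2 V → ℝ) (hm : ∑ ω, weight w ω = 1) (Sig : Finset V) :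
    EavMix w U A Sig v N = ∑ ω, weight w ω * EavMix w (U \ Z) A Sig v ((N \ ↑Z) ∪ rS U Z ω) := by
  have hZW : (↑Z : Set V) ⊆ A ∪ N := hZN.trans Set.subset_union_right
  have hvUZ : v ∈ U \ Z := Finset.mem_sdiff.2 ⟨hvU, hv⟩
  unfold EavMix
  rw [multiStep_sum hZU hv hZW Sig hZW w hm (hubInd Sig v)]
  refine Finset.sum_congr rfl fun ω _ => ?_
  congr 1
  refine Finset.sum_congr rfl fun ω' _ => ?_
  rw [rD_eq_of_agree (U \ Z) hvUZ (union_diff_agree U Z A N (rS U Z ω)),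
    avoidAll_eq_of_agree (U \ Z) Sig (union_diff_agree U Z A N (rS U Z ω))]

/-- `E^mix_A` only sees `(A ∪ N) ∩ U` (for `v ∈ U`). [folklore] -/
theorem EavMix_eq_inter (w : Sym2 V → ℝ) (U : Finset V) (A : Set V) (Sig : Finset V) {v : V} (hv : v ∈ U) (N : Set V) :
    EavMix w U A Sig v N = ∑ ω, weight w ω *
      (hubInd Sig v (rC U v ω) * ind (rD U v ((A ∪ N) ∩ ↑U)) ω * ind (avoidAll U Sig ((A ∪ N) ∩ ↑U)) ω) := by
  unfold EavMix
  rw [rD_inter_coe U hv, avoidAll_eq_of_agree U Sig (X := (A ∪ N) ∩ ↑U) (Y := A ∪ N)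
    fun _ haU => ⟨fun h => h.1, fun h => ⟨h, haU⟩⟩]

/-- `E^mix_A(N) = 0` when `v ∈ A ∪ N`. [folklore] -/
theorem EavMix_eq_zero_of_mem (w : Sym2 V → ℝ) (U : Finset V) (A : Set V) (Sig : Finset V) (v : V) {N : Set V}
    (hv : v ∈ A ∪ N) : EavMix w U A Sig v N = 0 :=
  Finset.sum_eq_zero fun ω _ => by
    rw [rD_eq_empty hv, ind_of_not_mem (Set.notMem_empty ω)]; ring

section Props

variable {w : Sym2 V → ℝ} (hw0 : ∀ e, 0 ≤ w e) (hw1 : ∀ e, w e ≤ 1)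
include hw0 hw1

/-- `E^mix_A(N) ≥ 0`. [folklore] -/
theorem EavMix_nonneg (U : Finset V) (A : Set V) (Sig : Finset V) (v : V) (N : Set V) : 0 ≤ EavMix w U A Sig v N :=
  Finset.sum_nonneg fun ω _ => mul_nonneg (weight_nonneg hw0 hw1 ω)
    (mul_nonneg (mul_nonneg (hubInd_nonneg _ _ _) (ind_nonneg _ _)) (ind_nonneg _ _))

/-- `E^mix_A(N) ≤ M_A(N)`. [folklore] -/
theorem EavMix_le_Mav (U : Finset V) (A : Set V) (Sig : Finset V) (v : V) (N : Set V) :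
    EavMix w U A Sig v N ≤ Mav w U A v N := by
  unfold EavMix Mav
  refine Finset.sum_le_sum fun ω _ => mul_le_mul_of_nonneg_left ?_ (weight_nonneg hw0 hw1 ω)
  have h1 := hubInd_le_one Sig v (rC U v ω)
  have h2 := ind_le_one (avoidAll U Sig (A ∪ N)) ω
  have h3 := ind_nonneg (rD U v (A ∪ N)) ω
  have h4 := hubInd_nonneg Sig v (rC U v ω)
  have h5 := ind_nonneg (avoidAll U Sig (A ∪ N)) ω
  nlinarith [mul_nonneg h4 h3, mul_nonneg (mul_nonneg h4 h3) h5]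

/-- `E^mix_A` is antitone in the source set. [cite: VandenbergHaggstromKahn2005, §1 p. 3] -/
theorem EavMix_antitone (U : Finset V) (A : Set V) (Sig : Finset V) (v : V) {N N' : Set V} (h : N ⊆ N') :
    EavMix w U A Sig v N' ≤ EavMix w U A Sig v N := by
  unfold EavMix
  refine Finset.sum_le_sum fun ω _ => mul_le_mul_of_nonneg_left ?_ (weight_nonneg hw0 hw1 ω)
  have hAN : A ∪ N ⊆ A ∪ N' := Set.union_subset_union_right A h
  exact mul_le_mul (mul_le_mul_of_nonneg_left (ind_mono (rD_antitone hAN) ω) (hubInd_nonneg _ _ _))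
    (ind_mono (avoidAll_antitone U Sig hAN) ω) (ind_nonneg _ _)
    (mul_nonneg (hubInd_nonneg _ _ _) (ind_nonneg _ _))

end Props

end Summit.CriticalPhenomena.PercolationContinuityZ3.Theorems.CovTau
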